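import Summits.BirchSwinnertonDyer.BirchSwinnertonDyer.Theorems.AdditiveBranchIMCGordTwoRankOneCertificate
import Summits.BirchSwinnertonDyer.Rank1Residual.Additive.CongruentPartnerMainConjectureX3Gord
import Summits.BirchSwinnertonDyer.Rank1Residual.Additive.GordBranchCertificateCurrencies
import Summits.BirchSwinnertonDyer.Rank1Residual.Additive.CongruentPartnerBranchPAdicGrossZagierIff
import Literature.NumberTheory.EllipticCurves.ZywinaCMImageProofs
import HarnessLib

/-!
# Route `AdditiveBranchIMC` (rung K1), crux `GordTwoRankOne` (item 19358): in analytic rank ONE the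
# Route-G budget at index `1` is FREE, so ONE `p`-adic unit — `‖A′‖_p = 1` — replaces the Λ-adic input
# (R1) at the pair; `BSD(E,p)` on the X4♯(G-ord) ∩ {`ρ̄` onto} rows of the crux from the readings + cite-only
# facts + that certificate (cell `bsd-addord`, seat `bsd-addord-k1-c3` gen 3, D-0074 row B2;
# `--supports stmt-BirchSwinnertonDyer-19358 --as helper`; eighth file of the seat)

HONEST FRAMING. THEOREMS ONLY: no definition, no named fact, no `sorry`, nothing booked; the
Birch–Swinnerton-Dyer conjecture is not proved by any of this and the crux `GordTwoRankOne` stays OPEN at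
class level (its residual inputs are exactly (R1) the Λ-adic branch containment `char_Λ X(E/ℚ_∞) ⊆ (𝓛_br)`
off the Case-1 rows — items 19244/19245's layer, NOT in print — and (R2) `A′(E,p) ≠ 0` on the non-CM pairs
— Schneider 1985-type non-degeneracy, rider I1, MATH-BOUND; TARGET E68/E74). Every published input below is
a named-fact BINDER: Kato 2004 Thm. 17.4 (3) read on the half eigenspace (`hK` =
`Wuthrich2014.kato_halfEigenCharIdeal_dvd_cyclotomicPrime_of_surjective`, a READING fact), Mazur 1972 Cor.
5.15 (`hMaz`), lit's conjoined fact (B) (`hCyc` = Disegni 2017 Thm. A/B + Delbourgo 2002 (B); `hCyc3` at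
`p = 3`), Artin formalism (`hArt`), Gross–Zagier I.(7.3) (`h73`), Waldspurger (`hWald`), Delbourgo 2002
(A)+(B) (`hDel` / `hDel3`), modularity (`hmod hmodD hmodN`), GZK (`hGZK`).

WHAT IS NEW (and why it was not available before 2026-08-26). The b2b-bsdres cell's ROUTE G
(`Additive/CongruentPartnerMainConjectureGord.lean`, 2026-08-21) proves the tame-branch main conjecture at a
pair from Kato's half + ONE unit coefficient of `ϖ·L_p(f_V, α, ω^{(p−1)/2}, T)` at index `b`
(`BranchUnitCoeffAt W p b`) + the typed budget `BudgetLeLambdaAt p W b` (`b ≤ λ(X(E/ℚ_∞))`), and hence the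
Λ-adic lower input `ChiBranchLowerDivisibility[Odd]At W p` (K-OUT). Its rank-one use was blocked on the
`p`-adic Gross–Zagier formula on the branch, which the gz seat has since made a KERNEL theorem from lit's
fact (B) (`branchPAdicGrossZagier_identity_of_cycLine`, p412307; odd p416794; `p = 3` intrinsic p420003) and
which this seat's gen 0 consumed (`cellGordTwo_missingLowerBoundAt_rankOne{,_odd,_three_intrinsic}_…`). The
observation of this file: **in analytic rank one the budget at index `1` is a THEOREM** —
`1 = rank E(ℚ) ≤ λ(X)` by GZK and `AdditivePotMult.budgetLeLambdaAt_of_le_mordellWeilRank` (Greenberg: `T^{rank}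
∣ char`) — and the index-`1` unit coefficient IS the certificate `A′ ≠ 0` in its strong form `‖A′‖_p = 1`
(`branchCoeffOneNeZeroAt_of_branchUnitCoeffAt_one`). So on X4♯(G-ord) ∩ `I₀*` ∩ {`ρ̄_{E,p}` onto} rows of
analytic rank `1`, ONE finite `p`-adic computation per pair — the `p`-adic valuation of the number `A′(E,p)`
the cell's engines already compute for the 383 booked X3♯ keys (HOME/proof/gz4/) being ZERO — gives
`BSD(E,p)` from the reading `hK` and the cite-only facts, at every odd `p` (both parities; `p = 3` anomalous or
not). Rows with `v_p(A′) ≥ 1` keep the general-index form (unit coefficient at `b` + a budget `b ≤ λ(X)` from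
any of the tree's suppliers: rank growth `budgetLeLambdaAt_of_layerRankGEAt`, EPW λ-shift, Prop. 4.14 +
residual count) or take the partner road of the sequel file `…GordTwoRankOnePartner.lean`.

* §0 `budgetLeLambdaAt_one_of_analyticRank_eq_one` — the free budget.
* §1 X4♯(G-ord) ∩ {`ρ̄` onto}, `p ≡ 1 (mod 4)`: `classX4Gord_bsdp_rankOne_of_chiBranchLower_of_cycLineFact_of_katoHalf`
  (gen 0's "O7 twin" with the Λ-adic input DISPLAYED instead of BSTW-OPEN, `¬CM` discharged by Serre),
  `…_of_katoHalf_of_coeffCert_of_budget` (index `b`), `…_of_katoHalf_of_unitCoeffOne` (ONE certificate).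
* §2 the odd twins, `p ≡ 3 (mod 4)`, `p ≥ 7`.
* §3 `p = 3`, anomalous OR NOT: `classX4Gord_bsdp_rankOne_three_intrinsic_of_chiBranchLowerOdd_of_cycLineFactThree_of_katoHalf`
  (hna-free core: CruxShape §0 lower half + Kato upper half), `…_of_coeffCert_of_budget`, `…_of_unitCoeffOne`.

References: [Kato2004Asterisque] Thm. 17.4 (3); [Delbourgo2002] Thm. (A), (B) (p. 40), Hypothesis (p. 39);
[Disegni2017] Thm. A, B; [Mazur1972Towers] Cor. 5.15; [GrossZagier1986] I.(7.3); [GreenbergLNM1716] Thm. 1.9,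
Lemma 3.1; [MazurTateTeitelbaum1986Invent] §I.13–14; [Serre1972] §4.5; [Pal2012] Thm. 3.2; [Miller2011LMS]
Def. 1.1; cell TARGET.md E74/E88, HOME/proof/PROOF-gz-kernel.md.
-/

set_option autoImplicit false
set_option linter.dupNamespace false

noncomputable section

open scoped Classical MatrixGroups ModularForm NumberField

open CongruenceSubgroup WeierstrassCurve NumberField IsDedekindDomain Field
  Literature.NumberTheory.EllipticCurves Literature.NumberTheory.EllipticCurves.ModularForms
  Literature.NumberTheory.EllipticCurves.GreenbergVatsal2000
  Literature.NumberTheory.EllipticCurves.Rank1Residual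
  Literature.NumberTheory.EllipticCurves.Rank1Residual.Typed
  Literature.NumberTheory.EllipticCurves.Delbourgo2002
  Literature.NumberTheory.EllipticCurves.Disegni2017
  Literature.NumberTheory.GaloisRepresentations
  Summit.BirchSwinnertonDyer.Rank1Residual.AdditivePotMult
  Summit.BirchSwinnertonDyer.Rank1Residual.Additive

namespace Summit.BirchSwinnertonDyer.BirchSwinnertonDyer.Theorems.AdditiveBranchIMCGordTwoRankOne

variable {W : WeierstrassCurve ℚ} [W.IsElliptic] [W.IsGloballyMinimal] {p : ℕ} [hp : Fact p.Prime]

/-! ### §0 The budget at index `1` is free in analytic rank `1` -/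

/-- **The Route-G budget at index `1` holds in analytic rank `1`**: `BudgetLeLambdaAt p W 1` ("`μ(X) = 0 ⟹
1 ≤ λ(X(E/ℚ_∞))`") from GZK (`rank E(ℚ) = r_an = 1`) and the tree theorem
`AdditivePotMult.budgetLeLambdaAt_of_le_mordellWeilRank` (`T^{rank} ∣ char_Λ X`, Greenberg LNM 1716 Lemma 3.1,
so `rank ≤ λ`). Any reduction type, any `p`. [cite: GreenbergLNM1716, §3 Lemma 3.1 and Thm. 1.9 (PDF p. 63)]
[cite: Darmon2004, Thm. 3.22 (GZK)] -/
theorem budgetLeLambdaAt_one_of_analyticRank_eq_one (hGZK : rank_eq_analyticRank_of_analyticRank_le_one)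
    (hr : W.analyticRank = 1) : BudgetLeLambdaAt p W 1 := by
  have hmw : W.mordellWeilRank = 1 := by rw [(hGZK W (by rw [hr])).1, hr]
  have hb : 1 ≤ W.mordellWeilRank := by rw [hmw]
  intro κ γ hκ hγ hcv D _ hX hmu
  exact budgetLeLambdaAt_of_le_mordellWeilRank hb hκ hγ hcv D hX hmu

/-! ### §1 X4♯(G-ord) ∩ `I₀*` ∩ {`ρ̄_{E,p}` onto}, `p ≡ 1 (mod 4)` -/

/-- **X4♯(G-ord) ∩ `I₀*` (`e = 2`) ∩ {`ρ̄_{E,p}` onto}, `p ≡ 1 (mod 4)`, `r_an = 1`, anomalous or not: `BSD(E,p)`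
from the per-pair Λ-adic input `ChiBranchLowerDivisibilityAt W p` (DISPLAYED), the published facts, Kato's half
and `A′ ≠ 0`.** Gen 0's `classX4Gord_bsdp_rankOne_of_BSTW921c_OPEN_of_cycLineFact_of_katoHalf` with the OPEN
BSTW clause replaced by the displayed input `hdiv` (so NO unrefereed claim enters) and the `¬CM` binder
DISCHARGED (`ClassX4Gord.not_hasCM_of_surj_of_five_le`: Serre, `p ≥ 5`). Chain: twist model; gen 0 §1 identity
(`exists_datum_identity_of_facts`); lower = gen 0 §2 core; Schneider from `A′ ≠ 0`; upper = Kato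
(`classX4Gord_missingUpperBoundAt_rankOne_of_katoHalf_of_identity`); glue. Nothing booked.
[cite: Kato2004Asterisque, Thm. 17.4 (3) (p. 273)] [cite: Delbourgo2002, Theorem (A), (B) (p. 40), p. 67 (iv), p. 69]
[cite: Disegni2017, Theorem A/B (arXiv v3 PDF 7–9)] [cite: Mazur1972Towers, Cor. 5.15] [cite: Serre1972, §4.5]
[cite: Miller2011LMS, Def. 1.1] -/
theorem classX4Gord_bsdp_rankOne_of_chiBranchLower_of_cycLineFact_of_katoHalf
    (hMaz : Mazur1972.cor515_universalNormIndex) (hCyc : delbourgoDatum_cycLineGrossZagier)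
    (hArt : rankinSelbergEulerProductHecke_baseChangeDirichlet_eq) (h73 : GrossZagier1986_thm_I_7_3)
    (hWald : waldspurger_exists_heegnerField_twist_ne_zero) (hDel : Delbourgo2002.mainTheorem)
    (hK : Wuthrich2014.kato_halfEigenCharIdeal_dvd_cyclotomicPrime_of_surjective)
    (hmod : hasEntireLFunction_rat) (hmodD : nonempty_modularParametrizationData)
    (hmodN : exists_isNewformOf) (hGZK : rank_eq_analyticRank_of_analyticRank_le_one)
    (hX : ClassX4Gord W p) (he : semistabilityIndex W p = 2) (hp4 : p % 4 = 1) (hsurj : Surj W p)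
    (hr : W.analyticRank = 1) (hdiv : ChiBranchLowerDivisibilityAt W p) (hne : BranchCoeffOneNeZeroAt W p) :
    BSDp W p := by
  -- adapted from gen 0's `classX4Gord_bsdp_rankOne_of_BSTW921c_OPEN_of_cycLineFact_of_katoHalf`
  have hp5 : 5 ≤ p := by have := hp.out.two_le; omega
  have hcm : ¬ W.HasCM := hX.not_hasCM_of_surj_of_five_le he hp5 hsurj
  -- the twist model, its newform and period ratio
  obtain ⟨V, iV, iVm, C, hV, hC⟩ := hX.exists_goodOrd_pStar_twist_model W p he
  have hordin : IsOrdinaryAt V p := ⟨hV.1, hV.2⟩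
  haveI : NeZero (V.conductorNorm ℤ) := ⟨(V.conductorNorm_pos_holds).ne'⟩
  obtain ⟨Dm⟩ := hmodD V
  obtain ⟨ϖ, -, hϖ, -⟩ := Dm.exists_rat_mul_realPeriodRat_eq_plusPeriod
  -- gen 0 §1: the datum and the identity
  obtain ⟨Dh, hBι, hB, u, q, hlead, hpgz⟩ := exists_datum_identity_of_facts hCyc hArt h73 hWald hmod
    hmodD hmodN hGZK hX.addv.2 hX.typeGOrd hp4 hcm hr V C hV hC Dm.isNewformOf ϖ hϖ
  -- lower half (gen 0 §2 core), Schneider, upper half, glue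
  have hl : MissingLowerBoundAt W p :=
    missingLowerBoundAt_rankOne_of_model_of_identity_of_chiBranchLower_of_branchCoeffOneNeZero hMaz hDel
      hmod hGZK hX.addv.2 hX.typeGOrd hp4 hcm hr V C hV hC Dm.f Dm.isNewformOf ϖ hϖ hBι hlead hpgz hdiv hne
  have hSch : SchneiderConjecture Dh :=
    schneiderConjecture_of_identity_of_branchCoeffOneNeZero hp4 hne V C hC hordin Dm.f Dm.isNewformOf ϖ
      hϖ hpgz
  have hu : MissingUpperBoundAt W p :=
    classX4Gord_missingUpperBoundAt_rankOne_of_katoHalf_of_identity hK hGZK hmod hX hp4 hsurj hr hB hSch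
      V hV C hC Dm.isNewformOf ϖ hϖ hlead hpgz
  exact bsdp_of_missingPPartAt W p hGZK (by rw [hr]) (missingPPartAt_of_lower_of_upper W p hl hu)

/-- **X4♯(G-ord) ∩ `I₀*` ∩ {`ρ̄_{E,p}` onto}, `p ≡ 1 (mod 4)`, `r_an = 1`: `BSD(E,p)` from the published facts,
Kato's half, ONE unit coefficient of `ϖ·L_p(f_V, α, ω^{(p−1)/2}, T)` at index `b` (`BranchUnitCoeffAt W p b`),
a budget `b ≤ λ(X(E/ℚ_∞))` (`BudgetLeLambdaAt p W b`) and `A′ ≠ 0`** — the Λ-adic input of the previous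
theorem supplied by Route G's K-OUT `ClassX4Gord.chiBranchLowerDivisibilityAt_of_katoHalf_of_coeffCert_of_budget`
(branch main conjecture with `μ = 0`, `λ = b` from Kato's half squeezed by the unit coefficient). The budget
is the per-pair input for the rows with `v_p(A′) ≥ 1` (then `b ≥ 2`: rank growth / EPW λ-shift / Prop. 4.14 +
residual count supply it in the tree); for `b = 1` see the next theorem. Nothing booked.
[cite: Kato2004Asterisque, Thm. 17.4 (3) (p. 273)] [cite: MazurTateTeitelbaum1986Invent, §I.13–I.14]
[cite: Delbourgo2002, Theorem (A), (B) (p. 40)] [cite: Disegni2017, Theorem A/B (arXiv v3 PDF 7–9)]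
[cite: Miller2011LMS, Def. 1.1] -/
theorem classX4Gord_bsdp_rankOne_of_katoHalf_of_coeffCert_of_budget
    (hMaz : Mazur1972.cor515_universalNormIndex) (hCyc : delbourgoDatum_cycLineGrossZagier)
    (hArt : rankinSelbergEulerProductHecke_baseChangeDirichlet_eq) (h73 : GrossZagier1986_thm_I_7_3)
    (hWald : waldspurger_exists_heegnerField_twist_ne_zero) (hDel : Delbourgo2002.mainTheorem)
    (hK : Wuthrich2014.kato_halfEigenCharIdeal_dvd_cyclotomicPrime_of_surjective)
    (hmod : hasEntireLFunction_rat) (hmodD : nonempty_modularParametrizationData)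
    (hmodN : exists_isNewformOf) (hGZK : rank_eq_analyticRank_of_analyticRank_le_one)
    (hX : ClassX4Gord W p) (he : semistabilityIndex W p = 2) (hp4 : p % 4 = 1) (hsurj : Surj W p)
    (hr : W.analyticRank = 1) {b : ℕ} (hcert : BranchUnitCoeffAt W p b) (hbud : BudgetLeLambdaAt p W b)
    (hne : BranchCoeffOneNeZeroAt W p) : BSDp W p :=
  classX4Gord_bsdp_rankOne_of_chiBranchLower_of_cycLineFact_of_katoHalf hMaz hCyc hArt h73 hWald hDel hK hmod
    hmodD hmodN hGZK hX he hp4 hsurj hr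
    (hX.chiBranchLowerDivisibilityAt_of_katoHalf_of_coeffCert_of_budget hK he hsurj hcert hbud) hne

/-- **ONE CERTIFICATE. X4♯(G-ord) ∩ `I₀*` ∩ {`ρ̄_{E,p}` onto}, `p ≡ 1 (mod 4)`, `r_an(E) = 1`, anomalous or not:
`BSD(E,p)` from the published facts, Kato's half-eigenspace reading, and `‖A′(E,p)‖_p = 1`** — i.e. the first
Taylor coefficient of the Néron-normalised branch `ϖ·L_p(f_V, α_p(V), ω^{(p−1)/2}, T)` is a `p`-adic UNIT for
every admissible datum `(V, C, f, ϖ)` (`BranchUnitCoeffAt W p 1`; one finite `p`-adic computation per pair —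
the valuation of the number whose non-vanishing the cell certifies on the X3♯ keys). The budget at index `1` is
§0's theorem and `A′ ≠ 0` follows from `‖A′‖ = 1`, so NO typed input remains besides the certificate: the
branch main conjecture holds at the pair with `μ = 0`, `λ = 1`, and both halves of `BSD(E,p)` follow (lower:
Delbourgo (A)+(B) + the kernel `p`-adic Gross–Zagier identity + Mazur's unit local index; upper: Kato). REACH
(honest): exactly the rows with `v_p(A′) = 0`; by the exact `v₁`-identity of the b2b cell
(`ClassX4Gord.schneider_and_padicVal_identity_rankOne_of_katoHalf_of_coeffCert_of_budget`) these are the rows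
with `ord_p #Ш(E) + ord_p(Reg_p/p) + ord_p ∏c_ℓ = 0` — the conclusion there is `ord_p #Ш(E)_an = 0 = ord_p #Ш(E)`,
which in analytic rank one is NOT a by-inspection statement (`#Ш_an` involves `L′(E,1)/Ω·Reg_∞`). Nothing booked.
[cite: Kato2004Asterisque, Thm. 17.4 (3) (p. 273)] [cite: MazurTateTeitelbaum1986Invent, §I.13–I.14]
[cite: GreenbergLNM1716, §3 Lemma 3.1] [cite: Delbourgo2002, Theorem (A), (B) (p. 40)]
[cite: Disegni2017, Theorem A/B (arXiv v3 PDF 7–9)] [cite: Miller2011LMS, Def. 1.1] -/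
theorem classX4Gord_bsdp_rankOne_of_katoHalf_of_unitCoeffOne
    (hMaz : Mazur1972.cor515_universalNormIndex) (hCyc : delbourgoDatum_cycLineGrossZagier)
    (hArt : rankinSelbergEulerProductHecke_baseChangeDirichlet_eq) (h73 : GrossZagier1986_thm_I_7_3)
    (hWald : waldspurger_exists_heegnerField_twist_ne_zero) (hDel : Delbourgo2002.mainTheorem)
    (hK : Wuthrich2014.kato_halfEigenCharIdeal_dvd_cyclotomicPrime_of_surjective)
    (hmod : hasEntireLFunction_rat) (hmodD : nonempty_modularParametrizationData)
    (hmodN : exists_isNewformOf) (hGZK : rank_eq_analyticRank_of_analyticRank_le_one)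
    (hX : ClassX4Gord W p) (he : semistabilityIndex W p = 2) (hp4 : p % 4 = 1) (hsurj : Surj W p)
    (hr : W.analyticRank = 1) (hone : BranchUnitCoeffAt W p 1) : BSDp W p :=
  classX4Gord_bsdp_rankOne_of_katoHalf_of_coeffCert_of_budget hMaz hCyc hArt h73 hWald hDel hK hmod hmodD
    hmodN hGZK hX he hp4 hsurj hr hone (budgetLeLambdaAt_one_of_analyticRank_eq_one hGZK hr)
    (branchCoeffOneNeZeroAt_of_branchUnitCoeffAt_one hone)

/-! ### §2 X4♯(G-ord) ∩ `I₀*` ∩ {`ρ̄_{E,p}` onto}, `p ≡ 3 (mod 4)`, `p ≥ 7` (odd branch, minus symbols) -/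

/-- **Odd branch, index `b`.** X4♯(G-ord) ∩ `I₀*` ∩ {`ρ̄_{E,p}` onto}, `p ≡ 3 (mod 4)`, `p ≥ 7`, `r_an = 1`:
`BSD(E,p)` from the published facts, Kato's half, `BranchUnitCoeffAt W p b` + `BudgetLeLambdaAt p W b` and
`A′ ≠ 0` — gen 0's `classX4Gord_bsdp_rankOne_odd_of_chiBranchLowerOdd_of_cycLineFact_of_katoHalf` (odd kernel
identity p416794) with its displayed odd Λ-adic input supplied by Route G's odd K-OUT and `¬CM` by Serre.
[cite: Kato2004Asterisque, Thm. 17.4 (3) (p. 273)] [cite: MazurTateTeitelbaum1986Invent, §I.13–I.14]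
[cite: Delbourgo2002, Theorem (A), (B) (p. 40)] [cite: Miller2011LMS, Def. 1.1] -/
theorem classX4Gord_bsdp_rankOne_odd_of_katoHalf_of_coeffCert_of_budget
    (hMaz : Mazur1972.cor515_universalNormIndex) (hCyc : delbourgoDatum_cycLineGrossZagier)
    (hArt : rankinSelbergEulerProductHecke_baseChangeDirichlet_eq) (h73 : GrossZagier1986_thm_I_7_3)
    (hWald : waldspurger_exists_heegnerField_twist_ne_zero) (hDel : Delbourgo2002.mainTheorem)
    (hK : Wuthrich2014.kato_halfEigenCharIdeal_dvd_cyclotomicPrime_of_surjective)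
    (hmod : hasEntireLFunction_rat) (hmodD : nonempty_modularParametrizationData)
    (hmodN : exists_isNewformOf) (hGZK : rank_eq_analyticRank_of_analyticRank_le_one)
    (hX : ClassX4Gord W p) (he : semistabilityIndex W p = 2) (hp4 : p % 4 = 3) (hp5 : 5 ≤ p)
    (hsurj : Surj W p) (hr : W.analyticRank = 1) {b : ℕ} (hcert : BranchUnitCoeffAt W p b)
    (hbud : BudgetLeLambdaAt p W b) (hne : BranchCoeffOneNeZeroAt W p) : BSDp W p :=
  classX4Gord_bsdp_rankOne_odd_of_chiBranchLowerOdd_of_cycLineFact_of_katoHalf hMaz hCyc hArt h73 hWald hDel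
    hK hmod hmodD hmodN hGZK hX he hp4 hp5 (hX.not_hasCM_of_surj_of_five_le he hp5 hsurj) hsurj hr
    (hX.chiBranchLowerDivisibilityOddAt_of_katoHalf_of_coeffCert_of_budget hK he hsurj hcert hbud) hne

/-- **Odd branch, ONE CERTIFICATE.** X4♯(G-ord) ∩ `I₀*` ∩ {`ρ̄_{E,p}` onto}, `p ≡ 3 (mod 4)`, `p ≥ 7`,
`r_an(E) = 1`: `BSD(E,p)` from the published facts, Kato's half-eigenspace reading, and `‖A′(E,p)‖_p = 1`
(`BranchUnitCoeffAt W p 1`, minus symbols, `ϖ·|Ω⁻_V| = Ω⁻_f`). Budget by §0, `A′ ≠ 0` from the unit. Nothing booked.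
[cite: Kato2004Asterisque, Thm. 17.4 (3) (p. 273)] [cite: MazurTateTeitelbaum1986Invent, §I.13–I.14]
[cite: GreenbergLNM1716, §3 Lemma 3.1] [cite: Delbourgo2002, Theorem (A), (B) (p. 40)] [cite: Miller2011LMS, Def. 1.1] -/
theorem classX4Gord_bsdp_rankOne_odd_of_katoHalf_of_unitCoeffOne
    (hMaz : Mazur1972.cor515_universalNormIndex) (hCyc : delbourgoDatum_cycLineGrossZagier)
    (hArt : rankinSelbergEulerProductHecke_baseChangeDirichlet_eq) (h73 : GrossZagier1986_thm_I_7_3)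
    (hWald : waldspurger_exists_heegnerField_twist_ne_zero) (hDel : Delbourgo2002.mainTheorem)
    (hK : Wuthrich2014.kato_halfEigenCharIdeal_dvd_cyclotomicPrime_of_surjective)
    (hmod : hasEntireLFunction_rat) (hmodD : nonempty_modularParametrizationData)
    (hmodN : exists_isNewformOf) (hGZK : rank_eq_analyticRank_of_analyticRank_le_one)
    (hX : ClassX4Gord W p) (he : semistabilityIndex W p = 2) (hp4 : p % 4 = 3) (hp5 : 5 ≤ p)
    (hsurj : Surj W p) (hr : W.analyticRank = 1) (hone : BranchUnitCoeffAt W p 1) : BSDp W p :=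
  classX4Gord_bsdp_rankOne_odd_of_katoHalf_of_coeffCert_of_budget hMaz hCyc hArt h73 hWald hDel hK hmod hmodD
    hmodN hGZK hX he hp4 hp5 hsurj hr hone (budgetLeLambdaAt_one_of_analyticRank_eq_one hGZK hr)
    (branchCoeffOneNeZeroAt_of_branchUnitCoeffAt_one hone)

/-! ### §3 X4♯(G-ord) at `p = 3` (∩ {`ρ̄_{E,3}` onto}, non-CM), anomalous OR NOT -/

/-- **X4♯(G-ord) at `p = 3` (`e = 2` automatic) ∩ {`ρ̄_{E,3}` onto}, non-CM, `r_an = 1`, ANOMALOUS OR NOT: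
`BSD(E,3)` from the per-pair odd Λ-adic input `ChiBranchLowerDivisibilityOddAt W 3` (DISPLAYED), the published
facts (`hK` for the upper half; `hMaz`, lit's `p = 3` (B♮) fact `hCyc3`, `hArt h73 hWald`, Delbourgo 2002 at `3`
`hDel3`, modularity, GZK) and `A′ ≠ 0`** — the hna-FREE `p = 3` core (gen 0's
`classX4Gord_bsdp_rankOne_three_of_chiBranchLowerOdd_of_cycLineFact_of_katoHalf` carries `hna`): X4 twin of gen
0's `classX3Gord_bsdp_rankOne_three_…_of_wuthrichHalf` — CruxShape §0 identity
(`exists_datum_identity_three_intrinsic_of_facts`), lower = `cellGordTwo_missingLowerBoundAt_rankOne_three_intrinsic_…`,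
Schneider from `A′ ≠ 0`, upper = Kato (`classX4Gord_missingUpperBoundAt_rankOne_of_katoHalf_of_identity_odd`).
The `¬CM` binder stays at `3` (Serre's discharge is `p ≥ 5`; per row it is a `j`-check). Nothing booked.
[cite: Kato2004Asterisque, Thm. 17.4 (3) (p. 273)] [cite: Delbourgo2002, Theorem (A), (B), Example (p. 40); Hypothesis (p. 39)]
[cite: Mazur1972Towers, Cor. 5.15] [cite: Miller2011LMS, Def. 1.1] -/
theorem classX4Gord_bsdp_rankOne_three_intrinsic_of_chiBranchLowerOdd_of_cycLineFactThree_of_katoHalf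
    [Fact (Nat.Prime 3)] {W : WeierstrassCurve ℚ} [W.IsElliptic] [W.IsGloballyMinimal]
    (hMaz : Mazur1972.cor515_universalNormIndex) (hCyc3 : delbourgoDatum_cycLineGrossZagier_intrinsicThree)
    (hArt : rankinSelbergEulerProductHecke_baseChangeDirichlet_eq) (h73 : GrossZagier1986_thm_I_7_3)
    (hWald : waldspurger_exists_heegnerField_twist_ne_zero) (hDel3 : Delbourgo2002.mainTheorem_three)
    (hK : Wuthrich2014.kato_halfEigenCharIdeal_dvd_cyclotomicPrime_of_surjective)
    (hmod : hasEntireLFunction_rat) (hmodD : nonempty_modularParametrizationData)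
    (hmodN : exists_isNewformOf) (hGZK : rank_eq_analyticRank_of_analyticRank_le_one)
    (hX : ClassX4Gord W 3) (hcm : ¬ W.HasCM) (hsurj : Surj W 3) (hr : W.analyticRank = 1)
    (hdiv : ChiBranchLowerDivisibilityOddAt W 3) (hne : BranchCoeffOneNeZeroAt W 3) : BSDp W 3 := by
  -- adapted from gen 0's `classX3Gord_bsdp_rankOne_three_of_chiBranchLowerOdd_of_cycLineFactThree_of_wuthrichHalf`
  have hp4 : (3 : ℕ) % 4 = 3 := by norm_num
  have hp2 : (3 : ℕ) ≠ 2 := by norm_num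
  have he : semistabilityIndex W 3 = 2 :=
    semistabilityIndex_eq_two_of_typeG_three W hX.typeGOrd.typeG hX.addv.2
  have hc : N10.CellGordTwo W 3 := ⟨hp2, hX.addv.2, hX.typeGOrd, he⟩
  obtain ⟨V, iV, iVm, C, hV, hC⟩ := hX.exists_goodOrd_pStar_twist_model W 3 he
  have hordin : IsOrdinaryAt V 3 := ⟨hV.1, hV.2⟩
  haveI : NeZero (V.conductorNorm ℤ) := ⟨(V.conductorNorm_pos_holds).ne'⟩
  obtain ⟨Dm⟩ := hmodD V
  obtain ⟨ϖ, -, hϖ⟩ := exists_rat_mul_imaginaryPeriodRat_eq_minusPeriod Dm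
  obtain ⟨Dh, -, hB, u, q, hlead, hpgz⟩ := exists_datum_identity_three_intrinsic_of_facts hCyc3 hArt h73
    hWald hmod hmodD hmodN hGZK hX.addv.2 hX.typeGOrd hcm hr V C hV hC Dm.isNewformOf ϖ hϖ
  have hl : MissingLowerBoundAt W 3 :=
    cellGordTwo_missingLowerBoundAt_rankOne_three_intrinsic_of_facts_of_chiBranchLowerOdd_of_branchCoeffOneNeZero
      hMaz hCyc3 hArt h73 hWald hDel3 hmod hmodD hmodN hGZK hc hcm hr hdiv hne
  have hSch : SchneiderConjecture Dh :=
    schneiderConjecture_of_identity_of_branchCoeffOneNeZero_odd hp4 hne V C hC hordin Dm.f Dm.isNewformOf ϖ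
      hϖ hpgz
  have hu : MissingUpperBoundAt W 3 :=
    classX4Gord_missingUpperBoundAt_rankOne_of_katoHalf_of_identity_odd hK hGZK hmod hX hp4 hsurj hr hB hSch
      V hV C hC Dm.isNewformOf ϖ hϖ hlead hpgz
  exact bsdp_of_missingPPartAt W 3 hGZK (by rw [hr]) (missingPPartAt_of_lower_of_upper W 3 hl hu)

/-- **`p = 3`, index `b`.** X4♯(G-ord) at `3` ∩ {`ρ̄_{E,3}` onto}, non-CM, `r_an = 1`, anomalous or not:
`BSD(E,3)` from the published facts, Kato's half, `BranchUnitCoeffAt W 3 b` + `BudgetLeLambdaAt 3 W b` and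
`A′ ≠ 0` — the odd K-OUT (`p = 3` included) into the previous theorem. [cite: Kato2004Asterisque, Thm. 17.4 (3) (p. 273)]
[cite: Delbourgo2002, Theorem (A), (B), Example (p. 40)] [cite: MazurTateTeitelbaum1986Invent, §I.13–I.14]
[cite: Miller2011LMS, Def. 1.1] -/
theorem classX4Gord_bsdp_rankOne_three_of_katoHalf_of_coeffCert_of_budget
    [Fact (Nat.Prime 3)] {W : WeierstrassCurve ℚ} [W.IsElliptic] [W.IsGloballyMinimal]
    (hMaz : Mazur1972.cor515_universalNormIndex) (hCyc3 : delbourgoDatum_cycLineGrossZagier_intrinsicThree)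
    (hArt : rankinSelbergEulerProductHecke_baseChangeDirichlet_eq) (h73 : GrossZagier1986_thm_I_7_3)
    (hWald : waldspurger_exists_heegnerField_twist_ne_zero) (hDel3 : Delbourgo2002.mainTheorem_three)
    (hK : Wuthrich2014.kato_halfEigenCharIdeal_dvd_cyclotomicPrime_of_surjective)
    (hmod : hasEntireLFunction_rat) (hmodD : nonempty_modularParametrizationData)
    (hmodN : exists_isNewformOf) (hGZK : rank_eq_analyticRank_of_analyticRank_le_one)
    (hX : ClassX4Gord W 3) (hcm : ¬ W.HasCM) (hsurj : Surj W 3) (hr : W.analyticRank = 1)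
    {b : ℕ} (hcert : BranchUnitCoeffAt W 3 b) (hbud : BudgetLeLambdaAt 3 W b)
    (hne : BranchCoeffOneNeZeroAt W 3) : BSDp W 3 :=
  have he : semistabilityIndex W 3 = 2 :=
    semistabilityIndex_eq_two_of_typeG_three W hX.typeGOrd.typeG hX.addv.2
  classX4Gord_bsdp_rankOne_three_intrinsic_of_chiBranchLowerOdd_of_cycLineFactThree_of_katoHalf hMaz hCyc3
    hArt h73 hWald hDel3 hK hmod hmodD hmodN hGZK hX hcm hsurj hr
    (hX.chiBranchLowerDivisibilityOddAt_of_katoHalf_of_coeffCert_of_budget hK he hsurj hcert hbud) hne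

/-- **`p = 3`, ONE CERTIFICATE.** X4♯(G-ord) at `3` ∩ {`ρ̄_{E,3}` onto}, non-CM, `r_an(E) = 1`, anomalous or
not: `BSD(E,3)` from the published facts, Kato's half-eigenspace reading, and `‖A′(E,3)‖_3 = 1`
(`BranchUnitCoeffAt W 3 1`). Budget by §0, `A′ ≠ 0` from the unit. Nothing booked.
[cite: Kato2004Asterisque, Thm. 17.4 (3) (p. 273)] [cite: Delbourgo2002, Theorem (A), (B), Example (p. 40)]
[cite: GreenbergLNM1716, §3 Lemma 3.1] [cite: Miller2011LMS, Def. 1.1] -/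
theorem classX4Gord_bsdp_rankOne_three_of_katoHalf_of_unitCoeffOne
    [Fact (Nat.Prime 3)] {W : WeierstrassCurve ℚ} [W.IsElliptic] [W.IsGloballyMinimal]
    (hMaz : Mazur1972.cor515_universalNormIndex) (hCyc3 : delbourgoDatum_cycLineGrossZagier_intrinsicThree)
    (hArt : rankinSelbergEulerProductHecke_baseChangeDirichlet_eq) (h73 : GrossZagier1986_thm_I_7_3)
    (hWald : waldspurger_exists_heegnerField_twist_ne_zero) (hDel3 : Delbourgo2002.mainTheorem_three)
    (hK : Wuthrich2014.kato_halfEigenCharIdeal_dvd_cyclotomicPrime_of_surjective)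
    (hmod : hasEntireLFunction_rat) (hmodD : nonempty_modularParametrizationData)
    (hmodN : exists_isNewformOf) (hGZK : rank_eq_analyticRank_of_analyticRank_le_one)
    (hX : ClassX4Gord W 3) (hcm : ¬ W.HasCM) (hsurj : Surj W 3) (hr : W.analyticRank = 1)
    (hone : BranchUnitCoeffAt W 3 1) : BSDp W 3 :=
  classX4Gord_bsdp_rankOne_three_of_katoHalf_of_coeffCert_of_budget hMaz hCyc3 hArt h73 hWald hDel3 hK hmod
    hmodD hmodN hGZK hX hcm hsurj hr hone (budgetLeLambdaAt_one_of_analyticRank_eq_one hGZK hr)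
    (branchCoeffOneNeZeroAt_of_branchUnitCoeffAt_one hone)

/-! ### §4 (appended) The `¬CM` binder at `p = 3` discharged: a surjective mod-`p` image forbids CM at EVERY odd `p` -/

omit [W.IsGloballyMinimal] in
/-- **Surjective `ρ̄_{E,p}` at an odd prime forbids CM** — Zywina 2015 Prop. 1.14/1.16 (Serre 1972 §4.5) is a
Literature THEOREM of the tree (`WeierstrassCurve.not_hasSurjectiveModNGaloisRep_of_hasCM`, every odd `ℓ`); so the
`¬ W.HasCM` binder of EVERY X4♯ ∩ {`ρ̄` onto} door is automatic, `p = 3` included (§1–§2 used Serre's `p ≥ 5` form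
through the twist). [cite: Zywina2015, Prop. 1.14 and Prop. 1.16 (§1.9)] [cite: Serre1972, §4.5] -/
theorem not_hasCM_of_surj_of_ne_two (hp2 : p ≠ 2) (hsurj : Surj W p) : ¬ W.HasCM :=
  fun hcm ↦ not_hasSurjectiveModNGaloisRep_of_hasCM W hcm hp.out hp2 hsurj

/-- **`p = 3`, index `b`, NO `¬CM` binder.** X4♯(G-ord) at `3` ∩ {`ρ̄_{E,3}` onto}, `r_an = 1`, anomalous or not:
`BSD(E,3)` from the published facts, Kato's half, `BranchUnitCoeffAt W 3 b` + `BudgetLeLambdaAt 3 W b` and `A′ ≠ 0`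
— §3 with `hcm := not_hasCM_of_surj_of_ne_two`. [cite: Kato2004Asterisque, Thm. 17.4 (3) (p. 273)]
[cite: Delbourgo2002, Theorem (A), (B), Example (p. 40)] [cite: Zywina2015, Prop. 1.14] [cite: Miller2011LMS, Def. 1.1] -/
theorem classX4Gord_bsdp_rankOne_three_of_katoHalf_of_coeffCert_of_budget_cmFree
    [Fact (Nat.Prime 3)] {W : WeierstrassCurve ℚ} [W.IsElliptic] [W.IsGloballyMinimal]
    (hMaz : Mazur1972.cor515_universalNormIndex) (hCyc3 : delbourgoDatum_cycLineGrossZagier_intrinsicThree)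
    (hArt : rankinSelbergEulerProductHecke_baseChangeDirichlet_eq) (h73 : GrossZagier1986_thm_I_7_3)
    (hWald : waldspurger_exists_heegnerField_twist_ne_zero) (hDel3 : Delbourgo2002.mainTheorem_three)
    (hK : Wuthrich2014.kato_halfEigenCharIdeal_dvd_cyclotomicPrime_of_surjective)
    (hmod : hasEntireLFunction_rat) (hmodD : nonempty_modularParametrizationData)
    (hmodN : exists_isNewformOf) (hGZK : rank_eq_analyticRank_of_analyticRank_le_one)
    (hX : ClassX4Gord W 3) (hsurj : Surj W 3) (hr : W.analyticRank = 1)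
    {b : ℕ} (hcert : BranchUnitCoeffAt W 3 b) (hbud : BudgetLeLambdaAt 3 W b)
    (hne : BranchCoeffOneNeZeroAt W 3) : BSDp W 3 :=
  classX4Gord_bsdp_rankOne_three_of_katoHalf_of_coeffCert_of_budget hMaz hCyc3 hArt h73 hWald hDel3 hK hmod hmodD
    hmodN hGZK hX (not_hasCM_of_surj_of_ne_two (by norm_num) hsurj) hsurj hr hcert hbud hne

/-- **`p = 3`, ONE CERTIFICATE, NO `¬CM` binder.** X4♯(G-ord) at `3` ∩ {`ρ̄_{E,3}` onto}, `r_an(E) = 1`, anomalous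
or not: `BSD(E,3)` from the published facts, Kato's half-eigenspace reading, and `‖A′(E,3)‖_3 = 1`
(`BranchUnitCoeffAt W 3 1`) — so at EVERY odd `p` the X4♯ one-certificate door carries no side condition on `E`
beyond its class binders. Nothing booked. [cite: Kato2004Asterisque, Thm. 17.4 (3) (p. 273)]
[cite: Delbourgo2002, Theorem (A), (B), Example (p. 40)] [cite: Zywina2015, Prop. 1.14] [cite: Miller2011LMS, Def. 1.1] -/
theorem classX4Gord_bsdp_rankOne_three_of_katoHalf_of_unitCoeffOne_cmFree
    [Fact (Nat.Prime 3)] {W : WeierstrassCurve ℚ} [W.IsElliptic] [W.IsGloballyMinimal]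
    (hMaz : Mazur1972.cor515_universalNormIndex) (hCyc3 : delbourgoDatum_cycLineGrossZagier_intrinsicThree)
    (hArt : rankinSelbergEulerProductHecke_baseChangeDirichlet_eq) (h73 : GrossZagier1986_thm_I_7_3)
    (hWald : waldspurger_exists_heegnerField_twist_ne_zero) (hDel3 : Delbourgo2002.mainTheorem_three)
    (hK : Wuthrich2014.kato_halfEigenCharIdeal_dvd_cyclotomicPrime_of_surjective)
    (hmod : hasEntireLFunction_rat) (hmodD : nonempty_modularParametrizationData)
    (hmodN : exists_isNewformOf) (hGZK : rank_eq_analyticRank_of_analyticRank_le_one)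
    (hX : ClassX4Gord W 3) (hsurj : Surj W 3) (hr : W.analyticRank = 1) (hone : BranchUnitCoeffAt W 3 1) :
    BSDp W 3 :=
  classX4Gord_bsdp_rankOne_three_of_katoHalf_of_unitCoeffOne hMaz hCyc3 hArt h73 hWald hDel3 hK hmod hmodD hmodN
    hGZK hX (not_hasCM_of_surj_of_ne_two (by norm_num) hsurj) hsurj hr hone

end Summit.BirchSwinnertonDyer.BirchSwinnertonDyer.Theorems.AdditiveBranchIMCGordTwoRankOne

end
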